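import Literature.MathematicalPhysics.QuantumFieldTheory.YangMillsOS
import Literature.MathematicalPhysics.QuantumFieldTheory.BalabanBanachStep
import Literature.MathematicalPhysics.QuantumLattice.LatticeGaugeDLR
import Summits.QuantumFields.YangMills.Theorems.HypercubicLimit.Negative.ReflectedDensity
import Summits.QuantumFields.YangMills.Theorems.HypercubicLimit.Negative.TelescopingGuards
import Summits.QuantumFields.YangMills.Theorems.LangevinControlUVOSLegsFromFemtoAndGapStubAssemblyStrings
import HarnessLib

/-!
# Route `PencilRigidity`, crux `HypercubicLimit` (stmt-QuantumFields-8646): vocabulary of line `conditional-mean-telescoping`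

Route-posited objects and statements (D-0016 `<Route><Crux>Defs` file) shared by the registered stubs of the
skeleton `Cruxes/HypercubicLimit/Lines/conditional_mean_telescoping.lean` (lead reshape 3, 2026-08-16) and by the
Theorems files that land them, in the skeleton's namespace (so the registered stub signatures are unchanged and
their landings are pure proof files).  NOTHING here is asserted: every `def … : Prop` is a statement some registered
stub proves or consumes ((L′), (WI), (W2), (NG), the derived Gaussian domination, the closure pieces (U), (S), (R))
or bookkeeping between them; `oneFieldLimit_of_legs` reassembles the closure.  The OBJECTS of the line are the
landed tree definitions of `Theorems/HypercubicLimit/Negative/ReflectedDensity.lean`, `…/TelescopingGuards.lean`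
(verbatim the skeleton's former local copies) and the sibling crux's `torusMomentStr` / `latticeDistStr` /
`latticeDist` (`Theorems/LangevinControlUVOSLegsFromFemtoAndGapStubAssemblyStrings.lean`).

* §0 the two remaining objects (`reflPair`, `smearedThreePoint`) and the plane-string weights `planeWeight`
  ((T)+(M) are LANDED — `stub_telescoping` — and stay in the skeleton).
* §2 (L′) `GapData`, `LatticeGapInput`.  §3 (WI)/(W2) `CornerFreeInfluence`, `InfluenceReverseHolder`,
  `WindowRegularity`.  §4 (NG) `NonGaussianFloor`.  §5 `GaussianDomination`.
* §6 the one-field form of the crux `OneFieldWitness`, `OneFieldLimit` (right-hand side of the landed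
  `Negative.OneFieldReduction.hypercubicLimit_iff_oneField`, verbatim).
* §7 the closure cut into three: (U) `UniformBound` — the a-uniform E0′-type bound on the RP-normalised
  plane-string distributions at shifted evaluation points; (S) `SoftData`/`SoftClauses`/`SoftLegs` — the scheme
  in units `a = m(β)`, the subsequential limits and the soft one-field clauses; (R) `ReflClauses`/`ReflectionLegs`
  — hermiticity, E2, E4, proper-hypercubic invariance and the continuum gap of such limits.

Refs: line card `Cruxes/HypercubicLimit/Lines/conditional-mean-telescoping.md`; `Disproof.lean` §§4, 10–12;
OsterwalderSchrader1975 §2 (E0′); OsterwalderSeiler1978 §§2–3; GlimmJaffe1987 §6.1, §19; JaffeWitten2000 §6.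
-/

set_option autoImplicit false

noncomputable section

open scoped SchwartzMap ENNReal
open MeasureTheory Filter Topology
open Literature.MathematicalPhysics.AQFT Literature.MathematicalPhysics.QuantumLattice
open Literature.MathematicalPhysics.QuantumFieldTheory
open Literature.Probability.LatticeModels (box Site)
open Summit.QuantumFields.YangMills.Theorems.HypercubicLimit.Negative
  (torusPlaquette torusDensity rpSquare influence)
open Summit.QuantumFields.YangMills.Theorems.OSLegsFromFemtoAndGap (torusMomentStr latticeDistStr latticeDist)

namespace Summit.QuantumFields.YangMills.Cruxes.HypercubicLimit.ConditionalMeanTelescoping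

local notation "E4" => EuclideanSpace ℝ (Fin 4)

section Objects

variable {G : Type} [Group G] [TopologicalSpace G] [IsTopologicalGroup G] [CompactSpace G]
  [MeasurableSpace G] [BorelSpace G]

/-- Reflected-pair two-point function of the ACTION DENSITY: `Cov(P_x ∘ θ, P_y)` on the torus of side `2S+1`,
`θ = GaugeConfig.timeReflect` (the summand of the lattice RP square of a smeared curvature field; `P ∘ θ` is the
action density with its temporal plaquettes hanging downward from `θx`). -/
def reflPair (r : LatticeRep G) (β : ℝ) (S : ℕ) (x y : Site 4) : ℝ :=
  let μ := wilsonMeasure (d := 4) (L := 2 * S + 1) r.ρ β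
  (∫ U, torusDensity r (2 * S + 1) x (GaugeConfig.timeReflect U) * torusDensity r (2 * S + 1) y U ∂μ) -
    (∫ U, torusDensity r (2 * S + 1) x (GaugeConfig.timeReflect U) ∂μ) *
      ∫ U, torusDensity r (2 * S + 1) y U ∂μ

/-- Smeared connected three-point function of the centred action density at lattice spacing `a` on the torus of
side `2S+1` (Riemann normalisation `a¹² = (a⁴)³`, no multiplicative renormalisation, centring by the torus
mean): the `κ₃` the closure renormalises by `c_k³`. -/
def smearedThreePoint (r : LatticeRep G) (β : ℝ) (S : ℕ) (a : ℝ) (φ₁ φ₂ φ₃ : 𝓢(E4, ℝ)) : ℝ :=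
  let μ := wilsonMeasure (d := 4) (L := 2 * S + 1) r.ρ β
  let δP : Site 4 → GaugeConfig 4 (2 * S + 1) G → ℝ :=
    fun x U => torusDensity r (2 * S + 1) x U - ∫ V, torusDensity r (2 * S + 1) x V ∂μ
  a ^ 12 * ∑ x ∈ box 4 S, ∑ y ∈ box 4 S, ∑ z ∈ box 4 S,
    φ₁ (a • siteToE x) * φ₂ (a • siteToE y) * φ₃ (a • siteToE z) * ∫ U, δP x U * δP y U * δP z U ∂μ

/-- The single-plane plaquette field `Re tr r.ρ(U_p)` of orientation `q = (i, j)` based at the origin. -/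
def planeObs (r : LatticeRep G) (q : Fin 4 × Fin 4) (U : LGConfig 4 G) : ℝ :=
  plaquetteObs r.ρ 0 q.1 q.2 U

/-- **Plane-string weight**: the centred mixed torus moment `W^{q}(x) = ∫ ∏ᵢ (p_{qᵢ}(xᵢ) − ⟨p_{qᵢ}⟩) dμ_{β,2S+1}`
(the sibling crux's `torusMomentStr` of the string `planeObs ∘ q`, centred by the torus means). -/
def planeWeight (r : LatticeRep G) (β : ℝ) (S : ℕ) {n : ℕ} (q : Fin n → Fin 4 × Fin 4) (x : Fin n → Site 4) : ℝ :=
  torusMomentStr r.ρ β S (fun i => planeObs r (q i)) (fun i => wilsonTorusMean r.ρ β S (planeObs r (q i))) x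

/-- The reference RP square at the NORMALISATION HEIGHT `⌊δ₀/a⌋` (physical height `δ₀`): `c_k = N^{-1/2}`. -/
def refSquare (r : LatticeRep G) (β : ℝ) (S : ℕ) (δ₀ a : ℝ) : ℝ :=
  rpSquare r β S ⌊δ₀ / a⌋₊

end Objects

/-! ## §2 (L′) The imported IR input: one-scale lattice gap with `ξ → ∞` -/

/-- **Gap data** for `(G, r)`: a rate `m` on `[β₁, ∞)` with (i) `0 < m → 0`; (ii) 8901-shape ALL-PAIRS volume-uniform
decay of connected time-correlations at rate `m(β)`; (iii) RP-SPECTRAL relative clustering of centred slab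
functionals with thermal error `ε(S) → 0`; (iv) axial comparability of the reference RP square beyond `c₂/m(β)`. -/
def GapData (G : Type) [Group G] [TopologicalSpace G] [IsTopologicalGroup G] [CompactSpace G]
    [MeasurableSpace G] [BorelSpace G] (r : LatticeRep G) (β₁ C₁ c₂ : ℝ) (m : ℝ → ℝ) : Prop :=
  (∀ β : ℝ, β₁ ≤ β → 0 < m β) ∧ Tendsto m atTop (𝓝 0) ∧
  (∀ A B : YMSpecies G, ∃ (C : ℝ) (S₀ : ℕ), ∀ β : ℝ, β₁ ≤ β → ∀ S : ℕ, S₀ ≤ S → ∀ n : ℕ, n ≤ S →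
      |latticeConnectedCorr r.ρ β (2 * S + 1) A.F B.F n| ≤ C * Real.exp (-(m β * n))) ∧
  (∀ β : ℝ, β₁ ≤ β → ∃ ε : ℕ → ℝ, Tendsto ε atTop (𝓝 0) ∧
      ∀ (S T n : ℕ), 2 * (T + n + 1) ≤ S →
        ∀ (Y : LGConfig 4 G → ℝ) (B : ℝ), Measurable Y → (∀ U, |Y U| ≤ B) →
          DependsOn Y {e : Literature.MathematicalPhysics.QuantumLattice.ZdEdge 4 |
              1 ≤ e.1 0 ∧ e.1 0 + (if e.2 = 0 then 1 else 0) ≤ T} →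
            let μ := wilsonMeasure (d := 4) (L := 2 * S + 1) r.ρ β
            |(∫ U, Y (torusLift (2 * S + 1) (GaugeConfig.timeReflect U)) *
                  Y (configShift (-Pi.single 0 (n : ℤ)) (torusLift (2 * S + 1) U)) ∂μ) -
                (∫ U, Y (torusLift (2 * S + 1) U) ∂μ) ^ 2|
              ≤ Real.exp (-(m β * n)) *
                  ((∫ U, Y (torusLift (2 * S + 1) (GaugeConfig.timeReflect U)) *
                      Y (torusLift (2 * S + 1) U) ∂μ) -
                    (∫ U, Y (torusLift (2 * S + 1) U) ∂μ) ^ 2) +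
                ε S * B ^ 2) ∧
  (∀ β : ℝ, β₁ ≤ β → ∃ S₀ : ℕ, ∀ S : ℕ, S₀ ≤ S → ∀ n : ℕ, c₂ / m β ≤ n → 4 * n + 8 ≤ S →
      Real.exp (-(C₁ * m β)) * rpSquare r β S n ≤ rpSquare r β S (n + 1))

/-- **(L′) Lattice gap input** (imported IR open problem, 8901/8941-shape): every compact simple `G` has gap data. -/
def LatticeGapInput : Prop :=
  ∀ (G : Type) [Group G] [TopologicalSpace G] [IsTopologicalGroup G] [CompactSpace G]
    [MeasurableSpace G] [BorelSpace G], IsCompactSimpleLieGroup G →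
    ∃ (r : LatticeRep G) (β₁ C₁ c₂ : ℝ) (m : ℝ → ℝ), GapData G r β₁ C₁ c₂ m

/-! ## §3 The window statements (ONE plaquette, below every fixed fraction of the correlation length) -/

/-- **(WI₂) Corner-free influence**: below `c₀/m(β)` the `L²` influence of the exterior of a cube of radius `R` on its
central plaquette is at most `C(c₀) √(reference RP square at height R)`; every base site, site-free constants. -/
def CornerFreeInfluence : Prop :=
  ∀ (G : Type) [Group G] [TopologicalSpace G] [IsTopologicalGroup G] [CompactSpace G]
    [MeasurableSpace G] [BorelSpace G], IsCompactSimpleLieGroup G →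
    ∀ (r : LatticeRep G) (β₁ C₁ c₂ : ℝ) (m : ℝ → ℝ), GapData G r β₁ C₁ c₂ m →
      ∀ c₀ : ℝ, 0 < c₀ → ∃ (C β₀ : ℝ), ∀ β : ℝ, β₀ ≤ β → ∃ S₀ : ℕ, ∀ S : ℕ, S₀ ≤ S →
        ∀ R : ℕ, 1 ≤ R → (R : ℝ) ≤ c₀ / m β → ∀ (x : Site 4) (i j : Fin 4), i ≠ j →
          influence r β S R x i j 2 ≤ C * Real.sqrt (rpSquare r β S R)

/-- **(WIₙ) Influence reverse Hölder**: below `c₀/m(β)`, `Lⁿ` influence `≤ C(c₀) n^γ ×` the `L²` influence. -/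
def InfluenceReverseHolder : Prop :=
  ∀ (G : Type) [Group G] [TopologicalSpace G] [IsTopologicalGroup G] [CompactSpace G]
    [MeasurableSpace G] [BorelSpace G], IsCompactSimpleLieGroup G →
    ∀ (r : LatticeRep G) (β₁ C₁ c₂ : ℝ) (m : ℝ → ℝ), GapData G r β₁ C₁ c₂ m →
      ∀ c₀ : ℝ, 0 < c₀ → ∃ (C β₀ : ℝ) (γ : ℕ), ∀ β : ℝ, β₀ ≤ β → ∀ n : ℕ, 2 ≤ n →
        ∃ S₀ : ℕ, ∀ S : ℕ, S₀ ≤ S → ∀ R : ℕ, 1 ≤ R → (R : ℝ) ≤ c₀ / m β →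
          ∀ (x : Site 4) (i j : Fin 4), i ≠ j →
            influence r β S R x i j n ≤ C * (n : ℝ) ^ γ * influence r β S R x i j 2

/-- **(W2) Window regularity of the reference RP square**: (a) polynomial doubling `A(R) ≤ C (R'/R)^p A(R')` for
`1 ≤ R ≤ R' ≤ c₀/m(β)`; (b) reflected-pair cone comparability `Cov(P_x ∘ θ, P_y) ≥ c · A(R)` for the action
density at heights in `[R, (1+θ)R]` and transverse offset `≤ θR`; (c) polynomial floor `A(β, S, 1) ≥ m(β)^q`. -/
def WindowRegularity : Prop :=
  ∀ (G : Type) [Group G] [TopologicalSpace G] [IsTopologicalGroup G] [CompactSpace G]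
    [MeasurableSpace G] [BorelSpace G], IsCompactSimpleLieGroup G →
    ∀ (r : LatticeRep G) (β₁ C₁ c₂ : ℝ) (m : ℝ → ℝ), GapData G r β₁ C₁ c₂ m →
      ∀ c₀ : ℝ, 0 < c₀ → ∃ (C c θ β₀ : ℝ) (p q : ℕ), 0 < c ∧ 0 < θ ∧
        ∀ β : ℝ, β₀ ≤ β → ∃ S₀ : ℕ, ∀ S : ℕ, S₀ ≤ S →
          (∀ R R' : ℕ, 1 ≤ R → R ≤ R' → (R' : ℝ) ≤ c₀ / m β →
              rpSquare r β S R ≤ C * ((R' : ℝ) / R) ^ p * rpSquare r β S R') ∧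
          (∀ (R : ℕ) (x y : Site 4), 1 ≤ R → (R : ℝ) ≤ c₀ / m β →
              (R : ℝ) ≤ x 0 → (x 0 : ℝ) ≤ (1 + θ) * R → (R : ℝ) ≤ y 0 → (y 0 : ℝ) ≤ (1 + θ) * R →
              (∀ i : Fin 4, i ≠ 0 → (|x i - y i| : ℝ) ≤ θ * R) →
                c * rpSquare r β S R ≤ reflPair r β S x y) ∧
          m β ^ q ≤ rpSquare r β S 1

/-- **(NG) Scale-free smeared `κ₃` floor**: at SOME physical scale `s₁`, for three fixed Schwartz bumps with
pairwise disjoint supports in the ball of radius `s₁`, the smeared connected three-point function of the action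
density at lattice spacing `m(β)` has a definite sign and is at least `c₁ A(⌊s₁/m(β)⌋)^{3/2}` in size. -/
def NonGaussianFloor : Prop :=
  ∀ (G : Type) [Group G] [TopologicalSpace G] [IsTopologicalGroup G] [CompactSpace G]
    [MeasurableSpace G] [BorelSpace G], IsCompactSimpleLieGroup G →
    ∀ (r : LatticeRep G) (β₁ C₁ c₂ : ℝ) (m : ℝ → ℝ), GapData G r β₁ C₁ c₂ m →
      ∃ (s₁ σ c₁ β₀ : ℝ) (φ₁ φ₂ φ₃ : 𝓢(E4, ℝ)), 0 < s₁ ∧ (σ = 1 ∨ σ = -1) ∧ 0 < c₁ ∧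
        tsupport φ₁ ⊆ Metric.ball 0 s₁ ∧ tsupport φ₂ ⊆ Metric.ball 0 s₁ ∧
        tsupport φ₃ ⊆ Metric.ball 0 s₁ ∧
        Disjoint (tsupport φ₁) (tsupport φ₂) ∧ Disjoint (tsupport φ₁) (tsupport φ₃) ∧
        Disjoint (tsupport φ₂) (tsupport φ₃) ∧
        ∀ β : ℝ, β₀ ≤ β → ∃ S₀ : ℕ, ∀ S : ℕ, S₀ ≤ S →
          c₁ * Real.sqrt (rpSquare r β S ⌊s₁ / m β⌋₊) ^ 3 ≤
            σ * smearedThreePoint r β S (m β) φ₁ φ₂ φ₃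

/-! ## §5 Gaussian domination of separated moments (derived from (T), (M), (WI₂), (WIₙ) in the skeleton) -/

/-- **Gaussian domination of separated moments**: for plaquettes pairwise more than `2R+1` apart and ANY window
radius `1 ≤ R' ≤ min(R, c₀/m(β))`, the torus `n`-point function of the centred plaquettes is at most
`(C n^γ √A(R'))ⁿ`. -/
def GaussianDomination : Prop :=
  ∀ (G : Type) [Group G] [TopologicalSpace G] [IsTopologicalGroup G] [CompactSpace G]
    [MeasurableSpace G] [BorelSpace G], IsCompactSimpleLieGroup G →
    ∀ (r : LatticeRep G) (β₁ C₁ c₂ : ℝ) (m : ℝ → ℝ), GapData G r β₁ C₁ c₂ m →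
      ∀ c₀ : ℝ, 0 < c₀ → ∃ (C β₀ : ℝ) (γ : ℕ), ∀ β : ℝ, β₀ ≤ β → ∀ n : ℕ, 2 ≤ n →
        ∃ S₀ : ℕ, ∀ S : ℕ, S₀ ≤ S →
          ∀ (R R' : ℕ) (o : Fin n → Fin 4 × Fin 4) (x : Fin n → Site 4),
            (∀ k, (o k).1 ≠ (o k).2) → 1 ≤ R' → R' ≤ R → (R' : ℝ) ≤ c₀ / m β →
            4 * R + 4 < 2 * S + 1 →
            (∀ k l, k ≠ l → ∃ μ : Fin 4, (2 * R + 1 : ℤ) < |x k μ - x l μ| ∧ |x k μ - x l μ| ≤ S) →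
              let μ := wilsonMeasure (d := 4) (L := 2 * S + 1) r.ρ β
              |∫ U, ∏ k, (torusPlaquette r (2 * S + 1) (o k).1 (o k).2 (x k) U -
                  ∫ V, torusPlaquette r (2 * S + 1) (o k).1 (o k).2 (x k) V ∂μ) ∂μ|
                ≤ (C * (n : ℝ) ^ γ * Real.sqrt (rpSquare r β S R')) ^ n

/-! ## §6 The one-field form of the crux -/

section OneField

variable {G : Type} [Group G] [TopologicalSpace G] [IsTopologicalGroup G] [CompactSpace G]
  [MeasurableSpace G] [BorelSpace G]

/-- **The one-field clauses** for one witness `(r, sch, S₁)` (verbatim the right-hand side of the landed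
`Negative.OneFieldReduction.hypercubicLimit_iff_oneField`). -/
def OneFieldWitness (r : LatticeRep G) (sch : SpeciesScheme (YMSpecies G)) (S₁ : SchwingerFamily E4) : Prop :=
  (S₁.toLabelled.IsNormalized ∧ S₁.toLabelled.IsHermitian ∧ S₁.toLabelled.HasLinearGrowth ∧
    S₁.toLabelled.IsReflectionPositive ∧ S₁.toLabelled.IsSymmetric ∧
    S₁.toLabelled.HasClusterProperty ∧
    (∀ (n : ℕ) (k : Fin n → Unit) (a : E4) (F : 𝓢((Fin n → E4), ℂ)), IsOffDiagonal F →
      S₁.toLabelled n k (translateMulti a F) = S₁.toLabelled n k F) ∧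
    (∀ (n : ℕ) (k : Fin n → Unit) (R : E4 ≃ₗᵢ[ℝ] E4),
      LinearMap.det (R.toLinearEquiv : E4 →ₗ[ℝ] E4) = 1 →
      (∀ i : Fin 4, ∃ j : Fin 4, R (EuclideanSpace.single i 1) = EuclideanSpace.single j 1 ∨
        R (EuclideanSpace.single i 1) = -EuclideanSpace.single j 1) →
      ∀ F : 𝓢((Fin n → E4), ℂ), IsOffDiagonal F →
        S₁.toLabelled n k (linActMulti R F) = S₁.toLabelled n k F)) ∧
  (∀ (n : ℕ), n ≠ 0 → ∀ (f : Fin n → 𝓢(E4, ℝ)) (F : 𝓢((Fin n → E4), ℂ)),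
    IsTensorOf F (fun i => ofRealTest (f i)) → IsOffDiagonal F →
      Tendsto (fun k : ℕ =>
        ((latticeSchwinger r.ρ sch (fun s => s.F) k n (fun _ => r.curvature) f : ℝ) : ℂ))
        atTop (𝓝 (S₁ n F))) ∧
  (∃ (F₁ G₁ : 𝓢((Fin 1 → E4), ℂ)) (H₁ : 𝓢((Fin (1 + 1) → E4), ℂ)),
    IsTimeOrdered F₁ ∧ IsTimeOrdered G₁ ∧ IsAppendTensorOf H₁ (osAdjoint F₁) G₁ ∧
      S₁ (1 + 1) H₁ ≠ S₁ 1 (osAdjoint F₁) * S₁ 1 G₁) ∧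
  (∃ (f g h : 𝓢(E4, ℂ)) (Ffgh : 𝓢((Fin 3 → E4), ℂ)) (Fgh Ffh Ffg : 𝓢((Fin 2 → E4), ℂ))
      (Ff Fg Fh : 𝓢((Fin 1 → E4), ℂ)),
    IsTensorOf Ffgh ![f, g, h] ∧ IsOffDiagonal Ffgh ∧ IsTensorOf Fgh ![g, h] ∧
    IsTensorOf Ffh ![f, h] ∧ IsTensorOf Ffg ![f, g] ∧ IsTensorOf Ff ![f] ∧ IsTensorOf Fg ![g] ∧
    IsTensorOf Fh ![h] ∧
      S₁ 3 Ffgh - S₁ 1 Ff * S₁ 2 Fgh - S₁ 1 Fg * S₁ 2 Ffh - S₁ 1 Fh * S₁ 2 Ffg +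
        2 * (S₁ 1 Ff * S₁ 1 Fg * S₁ 1 Fh) ≠ 0) ∧
  (∃ Δ : ℝ, 0 < Δ ∧ S₁.toLabelled.HasMassGap Δ ∧ HasLatticeMassGap r sch Δ)

end OneField

/-- **The one-field form of the crux**: every compact simple Lie group admits a `OneFieldWitness`. -/
def OneFieldLimit : Prop :=
  ∀ (G : Type) [Group G] [TopologicalSpace G] [IsTopologicalGroup G] [CompactSpace G],
    IsCompactSimpleLieGroup G →
      letI : MeasurableSpace G := borel G
      haveI : BorelSpace G := ⟨rfl⟩
      ∃ (r : LatticeRep G) (sch : SpeciesScheme (YMSpecies G)) (S₁ : SchwingerFamily E4),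
        OneFieldWitness r sch S₁

/-! ## §7 The closure, cut into (U) uniform bound, (S) soft legs, (R) reflection legs -/

/-- **(U) The a-uniform E0′-type bound on the RP-normalised plane-string distributions.**  In units `a = m(β)`,
normalised by `N = refSquare = rpSquare r β S ⌊δ₀/a⌋`: for `n ≥ 2`, large `β`, `S ≥ S₀(β, n)`: `N > 0` and for every
orientation string `q`, every evaluation map `y` within `6a` of the scaled sites and every `F ∈ ⁰𝒮ₙ`,
`a⁴ⁿ ‖Σ_{x ∈ (box S)ⁿ} W^{q}(x) F(y(x))‖ ≤ (K n^γ √N)ⁿ schwartzNorm (s n) F`, ONE `K, γ, s` (three zones — wrap,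
near-diagonal, separated — fed by `GaussianDomination`, `WindowRegularity` (a),(c), `GapData` (i)). -/
def UniformBound : Prop :=
  ∀ (G : Type) [Group G] [TopologicalSpace G] [IsTopologicalGroup G] [CompactSpace G]
    [MeasurableSpace G] [BorelSpace G], IsCompactSimpleLieGroup G →
    ∀ (r : LatticeRep G) (β₁ C₁ c₂ : ℝ) (m : ℝ → ℝ), GapData G r β₁ C₁ c₂ m →
      ∀ δ₀ : ℝ, 0 < δ₀ → ∃ (K β₀ : ℝ) (γ s : ℕ), ∀ β : ℝ, β₀ ≤ β → ∀ n : ℕ, 2 ≤ n →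
        ∃ S₀ : ℕ, ∀ S : ℕ, S₀ ≤ S →
          0 < refSquare r β S δ₀ (m β) ∧
          ∀ (q : Fin n → Fin 4 × Fin 4), (∀ i, (q i).1 ≠ (q i).2) →
            ∀ (y : (Fin n → Site 4) → (Fin n → E4)),
              (∀ x l, ‖y x l - m β • siteToE (x l)‖ ≤ 6 * m β) →
              ∀ F : 𝓢((Fin n → E4), ℂ), IsOffDiagonal F →
                m β ^ (4 * n) *
                    ‖∑ x ∈ Fintype.piFinset (fun _ : Fin n => box 4 S),
                        ((planeWeight r β S q x : ℝ) : ℂ) * F (y x)‖ ≤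
                  (K * (n : ℝ) ^ γ * Real.sqrt (refSquare r β S δ₀ (m β))) ^ n *
                    schwartzNorm (s * n) F

section SoftData

variable {G : Type} [Group G] [TopologicalSpace G] [IsTopologicalGroup G] [CompactSpace G]
  [MeasurableSpace G] [BorelSpace G]

/-- **The scheme in units `a = m(β)` and its subsequential limits — the data (S) hands to (R)**: units clause,
`β_k → ∞`, torus demand `Λ(β_k, k) ≤ L_k`, `N_k > 0`, `c_k = N_k^{-1/2}`, exact centring; convergence on `⁰𝒮` of
the normalised plane-string distributions to `Spl n q` and of the normalised density distributions to `S₁ n`; the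
plane expansion of `S₁ n` (`n ≥ 2`), `S₁ 0 = δ`, `S₁ 1 = 0`; ONE a-uniform bound at shifted evaluation points along
the scheme (eventually in `k`, per `n ≥ 2`) and for the limits; E3 and translation invariance of every `Spl n q`. -/
def SoftData (r : LatticeRep G) (m : ℝ → ℝ) (δ₀ : ℝ) (Λ : ℝ → ℕ → ℕ) (sch : SpeciesScheme (YMSpecies G))
    (S₁ : SchwingerFamily E4)
    (Spl : (n : ℕ) → (Fin n → Fin 4 × Fin 4) → (𝓢((Fin n → E4), ℂ) →L[ℂ] ℂ)) : Prop :=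
  (∀ k, sch.a k = m (sch.β k)) ∧ Tendsto sch.β atTop atTop ∧ (∀ k, Λ (sch.β k) k ≤ sch.L k) ∧
  (∀ k, 0 < refSquare r (sch.β k) (sch.L k) δ₀ (sch.a k)) ∧
  (∀ k, sch.c r.curvature k = (Real.sqrt (refSquare r (sch.β k) (sch.L k) δ₀ (sch.a k)))⁻¹) ∧
  (∀ k, sch.m r.curvature k = wilsonTorusMean r.ρ (sch.β k) (sch.L k) r.curvature.F) ∧
  (∀ (n : ℕ) (q : Fin n → Fin 4 × Fin 4), (∀ i, (q i).1 ≠ (q i).2) →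
    ∀ F : 𝓢((Fin n → E4), ℂ), IsOffDiagonal F →
      Tendsto (fun k => (((sch.c r.curvature k * sch.a k ^ 4) ^ n : ℝ) : ℂ) *
        latticeDistStr r.ρ (sch.β k) (sch.L k) (sch.a k) (fun i => planeObs r (q i))
          (fun i => wilsonTorusMean r.ρ (sch.β k) (sch.L k) (planeObs r (q i))) F) atTop (𝓝 (Spl n q F))) ∧
  (∀ (n : ℕ) (F : 𝓢((Fin n → E4), ℂ)), IsOffDiagonal F →
      Tendsto (fun k => (((sch.c r.curvature k * sch.a k ^ 4) ^ n : ℝ) : ℂ) *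
        latticeDist r.ρ (sch.β k) (sch.L k) (sch.a k) r.curvature.F
          (wilsonTorusMean r.ρ (sch.β k) (sch.L k) r.curvature.F) n F) atTop (𝓝 (S₁ n F))) ∧
  (∀ n : ℕ, 2 ≤ n → ∀ F : 𝓢((Fin n → E4), ℂ), IsOffDiagonal F →
      S₁ n F = ∑ q ∈ Fintype.piFinset (fun _ : Fin n => Finset.univ.filter fun p : Fin 4 × Fin 4 => p.1 < p.2),
        Spl n q F) ∧
  (∀ F : 𝓢((Fin 0 → E4), ℂ), S₁ 0 F = F default) ∧ (∀ F : 𝓢((Fin 1 → E4), ℂ), S₁ 1 F = 0) ∧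
  (∃ (K : ℝ) (γ s : ℕ), 0 ≤ K ∧
    (∀ n : ℕ, 2 ≤ n → ∀ᶠ k in atTop, ∀ (q : Fin n → Fin 4 × Fin 4), (∀ i, (q i).1 ≠ (q i).2) →
      ∀ (y : (Fin n → Site 4) → (Fin n → E4)), (∀ x l, ‖y x l - sch.a k • siteToE (x l)‖ ≤ 6 * sch.a k) →
        ∀ F : 𝓢((Fin n → E4), ℂ), IsOffDiagonal F →
          (sch.c r.curvature k * sch.a k ^ 4) ^ n *
              ‖∑ x ∈ Fintype.piFinset (fun _ : Fin n => box 4 (sch.L k)),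
                  ((planeWeight r (sch.β k) (sch.L k) q x : ℝ) : ℂ) * F (y x)‖ ≤
            (K * (n : ℝ) ^ γ) ^ n * schwartzNorm (s * n) F) ∧
    (∀ (n : ℕ) (q : Fin n → Fin 4 × Fin 4) (F : 𝓢((Fin n → E4), ℂ)),
      ‖Spl n q F‖ ≤ (K * (n : ℝ) ^ γ) ^ n * schwartzNorm (s * n) F) ∧
    (∀ (n : ℕ) (F : 𝓢((Fin n → E4), ℂ)), ‖S₁ n F‖ ≤ (6 * K * (n : ℝ) ^ γ + 1) ^ n * schwartzNorm (s * n) F)) ∧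
  (∀ (n : ℕ) (q : Fin n → Fin 4 × Fin 4) (π : Equiv.Perm (Fin n)) (F : 𝓢((Fin n → E4), ℂ)),
      IsOffDiagonal F → Spl n q (permTest π F) = Spl n (q ∘ π) F) ∧
  (∀ (n : ℕ) (q : Fin n → Fin 4 × Fin 4) (t : E4) (F : 𝓢((Fin n → E4), ℂ)),
      IsOffDiagonal F → Spl n q (translateMulti t F) = Spl n q F)

/-- **The soft one-field clauses** of `OneFieldWitness` (those needing no reflection): E0-normalisation, E0′,
E3, invariance under all translations on `⁰𝒮`, the one-field convergence clause along `sch`, non-triviality,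
non-Gaussianity, and the uniform lattice gap at rate `1` in units `a`. -/
def SoftClauses (r : LatticeRep G) (sch : SpeciesScheme (YMSpecies G)) (S₁ : SchwingerFamily E4) : Prop :=
  S₁.toLabelled.IsNormalized ∧ S₁.toLabelled.HasLinearGrowth ∧ S₁.toLabelled.IsSymmetric ∧
  (∀ (n : ℕ) (k : Fin n → Unit) (a : E4) (F : 𝓢((Fin n → E4), ℂ)), IsOffDiagonal F →
    S₁.toLabelled n k (translateMulti a F) = S₁.toLabelled n k F) ∧
  (∀ (n : ℕ), n ≠ 0 → ∀ (f : Fin n → 𝓢(E4, ℝ)) (F : 𝓢((Fin n → E4), ℂ)),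
    IsTensorOf F (fun i => ofRealTest (f i)) → IsOffDiagonal F →
      Tendsto (fun k : ℕ =>
        ((latticeSchwinger r.ρ sch (fun s => s.F) k n (fun _ => r.curvature) f : ℝ) : ℂ))
        atTop (𝓝 (S₁ n F))) ∧
  (∃ (F₁ G₁ : 𝓢((Fin 1 → E4), ℂ)) (H₁ : 𝓢((Fin (1 + 1) → E4), ℂ)),
    IsTimeOrdered F₁ ∧ IsTimeOrdered G₁ ∧ IsAppendTensorOf H₁ (osAdjoint F₁) G₁ ∧
      S₁ (1 + 1) H₁ ≠ S₁ 1 (osAdjoint F₁) * S₁ 1 G₁) ∧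
  (∃ (f g h : 𝓢(E4, ℂ)) (Ffgh : 𝓢((Fin 3 → E4), ℂ)) (Fgh Ffh Ffg : 𝓢((Fin 2 → E4), ℂ))
      (Ff Fg Fh : 𝓢((Fin 1 → E4), ℂ)),
    IsTensorOf Ffgh ![f, g, h] ∧ IsOffDiagonal Ffgh ∧ IsTensorOf Fgh ![g, h] ∧
    IsTensorOf Ffh ![f, h] ∧ IsTensorOf Ffg ![f, g] ∧ IsTensorOf Ff ![f] ∧ IsTensorOf Fg ![g] ∧
    IsTensorOf Fh ![h] ∧
      S₁ 3 Ffgh - S₁ 1 Ff * S₁ 2 Fgh - S₁ 1 Fg * S₁ 2 Ffh - S₁ 1 Fh * S₁ 2 Ffg +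
        2 * (S₁ 1 Ff * S₁ 1 Fg * S₁ 1 Fh) ≠ 0) ∧
  HasLatticeMassGap r sch 1

/-- **The reflection clauses** of `OneFieldWitness`: E0-hermiticity, E2, E4, proper-hypercubic invariance on
`⁰𝒮`, and the continuum mass gap at rate `1` (units `a = m(β)`). -/
def ReflClauses (S₁ : SchwingerFamily E4) : Prop :=
  S₁.toLabelled.IsHermitian ∧ S₁.toLabelled.IsReflectionPositive ∧ S₁.toLabelled.HasClusterProperty ∧
  (∀ (n : ℕ) (k : Fin n → Unit) (R : E4 ≃ₗᵢ[ℝ] E4),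
    LinearMap.det (R.toLinearEquiv : E4 →ₗ[ℝ] E4) = 1 →
    (∀ i : Fin 4, ∃ j : Fin 4, R (EuclideanSpace.single i 1) = EuclideanSpace.single j 1 ∨
      R (EuclideanSpace.single i 1) = -EuclideanSpace.single j 1) →
    ∀ F : 𝓢((Fin n → E4), ℂ), IsOffDiagonal F →
      S₁.toLabelled n k (linActMulti R F) = S₁.toLabelled n k F) ∧
  S₁.toLabelled.HasMassGap 1

end SoftData

/-- **(S) Soft legs.**  From (U), (W2), (NG): for every `(G, r)` with gap data and EVERY torus demand `Λ` there are
`δ₀ > 0`, a scheme, a one-field family and plane-string limits with `SoftData` and `SoftClauses` (diagonal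
subsequence + Hahn–Banach on `⁰𝒮`; E0, E3, translations inherited; E0′ from (U); non-triviality from (W2b) at the
normalisation height, the reflection swaps costing `O(a_k)` by (U) at shifted points; non-Gaussianity from (NG) +
(W2a) with `δ₀ ≤ s₁`; `HasLatticeMassGap r sch 1` from (L′ii), landed `allPairsDecay_hasLatticeMassGap`). -/
def SoftLegs : Prop :=
  ∀ (G : Type) [Group G] [TopologicalSpace G] [IsTopologicalGroup G] [CompactSpace G]
    [MeasurableSpace G] [BorelSpace G], IsCompactSimpleLieGroup G →
    ∀ (r : LatticeRep G) (β₁ C₁ c₂ : ℝ) (m : ℝ → ℝ), GapData G r β₁ C₁ c₂ m →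
      ∀ Λ : ℝ → ℕ → ℕ, ∃ (δ₀ : ℝ) (sch : SpeciesScheme (YMSpecies G)) (S₁ : SchwingerFamily E4)
        (Spl : (n : ℕ) → (Fin n → Fin 4 × Fin 4) → (𝓢((Fin n → E4), ℂ) →L[ℂ] ℂ)),
        0 < δ₀ ∧ SoftData r m δ₀ Λ sch S₁ Spl ∧ SoftClauses r sch S₁

/-- **(R) Reflection legs.**  For every `(G, r)` with gap data there is a torus demand `Λ` (absorbing the thermal
error `ε(S)` of (L′iii) against the `k`-dependent sup norms of the normalised slab polynomials) such that EVERY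
`SoftData` witness obeying it satisfies `ReflClauses`: hermiticity, E2 and signed permutations from the odd-torus RP
and the hyperoctahedral symmetry of Wilson's measure via the exact plane-family reflection identities up to one-step
shifts (shifted uniform bound + shift defect `O(a_k)`); E4 and `HasMassGap 1` from (L′iii) in units `a_k`. -/
def ReflectionLegs : Prop :=
  ∀ (G : Type) [Group G] [TopologicalSpace G] [IsTopologicalGroup G] [CompactSpace G]
    [MeasurableSpace G] [BorelSpace G], IsCompactSimpleLieGroup G →
    ∀ (r : LatticeRep G) (β₁ C₁ c₂ : ℝ) (m : ℝ → ℝ), GapData G r β₁ C₁ c₂ m →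
      ∃ Λ : ℝ → ℕ → ℕ, ∀ (δ₀ : ℝ) (sch : SpeciesScheme (YMSpecies G)) (S₁ : SchwingerFamily E4)
        (Spl : (n : ℕ) → (Fin n → Fin 4 × Fin 4) → (𝓢((Fin n → E4), ℂ) →L[ℂ] ℂ)),
        0 < δ₀ → SoftData r m δ₀ Λ sch S₁ Spl → ReflClauses S₁

/-- **The closure, reassembled (pure logic):** (L′) supplies `r` and the gap data, (R) the torus demand `Λ`, (S) the
scheme and the limits for that demand; `SoftClauses ∧ ReflClauses` are the clauses of `OneFieldWitness` with `Δ = 1`. -/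
theorem oneFieldLimit_of_legs : LatticeGapInput → SoftLegs → ReflectionLegs → OneFieldLimit := by
  intro hL hS hR G _ _ _ _ hG
  letI : MeasurableSpace G := borel G
  haveI : BorelSpace G := ⟨rfl⟩
  obtain ⟨r, β₁, C₁, c₂, m, hgap⟩ := hL G hG
  obtain ⟨Λ, hΛ⟩ := hR G hG r β₁ C₁ c₂ m hgap
  obtain ⟨δ₀, sch, S₁, Spl, hδ₀, hD, hE0, hE0', hE3, htr, hconv, hNT, hNG, hlat⟩ := hS G hG r β₁ C₁ c₂ m hgap Λ
  obtain ⟨hherm, hRP, hcl, hhyp, hgap1⟩ := hΛ δ₀ sch S₁ Spl hδ₀ hD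
  exact ⟨r, sch, S₁, ⟨hE0, hherm, hE0', hRP, hE3, hcl, htr, hhyp⟩, hconv, hNT, hNG, 1, one_pos, hgap1, hlat⟩

end Summit.QuantumFields.YangMills.Cruxes.HypercubicLimit.ConditionalMeanTelescoping

end
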